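import Summits.ResolutionOfSingularities.ResolutionOfSingularities.Theorems.FrobeniusLadderFInjectiveMacaulayficationFullLastCentreBed178Instance
import Summits.ResolutionOfSingularities.ResolutionOfSingularities.Theorems.FrobeniusLadderFInjectiveMacaulayficationFullLastCentreTopLocus
import HarnessLib

/-!
# «cc ≠ CANONICAL» AT BED 178, KERNEL: the last centre of the `ρ = 9` record is coordinate-canonical but NOT the top locus (two triple axes through `x₃`)
# (crux `FInjectiveMacaulayfication` stmt-ResolutionOfSingularities-15315, chain w45a; res-L1-w45a-plan-1 R26.13 (a)/(3) «cc⁺ FAILS at the last centre of BOTH canonlast-9 records (bed 178: two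
# triple axes through x₃ …) ⇒ `TopLocusIs` is false there … concrete "cc ≠ canonical" witnesses (one T-register row, rev 12)»; instance = ✓p731555 `…FullLastCentreBed178Instance`
# (res-L1-w45a-stub-1 g17; record of res-L1-w45a-lead-1 g16ʼs kit j332890), criterion = `…FullLastCentreTopLocus`; seat res-L1-w45a-stub-1 g17)

[OURS · L1 W4.5a] Support file (`--supports stmt-ResolutionOfSingularities-15315 --as helper`); theorems only; NOT a statement of any manuscript; nothing of the crux is proved. At the stage `S` of
bed 178 (letters `(y₁, e₁, y₃, e₂) = 0..3`) the cubic is normally flat of multiplicity 3 along BOTH the `e₂`-axis `Z = V(x, y₁, e₁, y₃)` (`Nor = {0,1,2}`, the recordʼs centre) and the `e₁`-axis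
`Z′ = V(x, y₁, y₃, e₂)` (`Nor′ = {0,2,3}`) — so by ✓ `not_topLocusIs_of_permissible` NEITHER axis is the top locus (`Sing₃ ⊇ Z ∪ Z′`; rule (b) of record would blow up the POINT `x₃`), while `Z`
IS coordinate-canonical (✓p731555 `coordCanonical`). Consequence of record: the kernel negative ✓p731555 `not_mc8cOneStep_coordCanonical` does not bear on the door candidate
`MC8cOneStep TopLocusIs` — certified here, not just asserted. AI-written (AI review is weaker than expert review). [folklore computation]
-/

-- single-problem summit: the doubled namespace component is forced
set_option linter.dupNamespace false

noncomputable section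

open MvPolynomial Finsupp

namespace Summit.ResolutionOfSingularities.ResolutionOfSingularities.Theorems.FInjectiveMacaulayfication.LastCentreBed178

open Summit.ResolutionOfSingularities.ResolutionOfSingularities.Theorems.FInjectiveMacaulayfication LastCentreDefs KLocCellKit LastCentreKit LastCentreTopLocus

variable (K : Type) [Field K]

/-- `norDeg {0,2,3} e = e 0 + e 2 + e 3`. [plumbing] -/
theorem norDeg_e1Axis (e : Expo) : norDeg ({0, 2, 3} : Finset Letter) e = e 0 + e 2 + e 3 := by
  simp [norDeg, add_assoc]

/-- THE SECOND TRIPLE AXIS: `S` is permissible along the `e₁`-axis `V(x, y₁, y₃, e₂)` as well (`bᵢ ∈ I_{Z′}^{3−i}` on the three supports). [OURS · certificate] -/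
theorem permissible_e1Axis : Permissible (S K) ({0, 2, 3} : Finset Letter) := by
  refine ⟨fun e he => ?_, fun e he => ?_, fun e he => ?_⟩
  · have h := forall_support_of_list (K := K) b2L (fun v => 1 ≤ v 0 + v 2 + v 3) (by decide) e he
    simpa [norDeg_e1Axis] using h
  · have h := forall_support_of_list (K := K) b1L (fun v => 2 ≤ v 0 + v 2 + v 3) (by decide) e he
    simpa [norDeg_e1Axis] using h
  · have h := forall_support_of_list (K := K) b0L (fun v => 3 ≤ v 0 + v 2 + v 3) (by decide) e he
    simpa [norDeg_e1Axis] using h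

/-- ★★ THE RECORDʼS CENTRE IS NOT THE TOP LOCUS: `¬ TopLocusIs S {0,1,2}` (the `e₁`-axis is a second equimultiple coordinate curve through `x₃`, and `e₁ ∈ Nor ∖ Nor′`). [OURS · kernel] -/
theorem not_topLocusIs : ¬ TopLocusIs (S K) Nor :=
  not_topLocusIs_of_permissible (S K) (permissible_e1Axis K) ⟨1, by simp [Nor], by decide⟩

/-- … and symmetrically the `e₁`-axis is not the top locus either (`e₂ ∈ Nor′ ∖ Nor`): under rule (b) the centre at `x₃` is the POINT. [OURS · kernel] -/
theorem not_topLocusIs_e1Axis : ¬ TopLocusIs (S K) ({0, 2, 3} : Finset Letter) :=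
  not_topLocusIs_of_permissible (S K) (permissible K) ⟨3, by decide, by simp [Nor]⟩

/-- ★★ **«cc ≠ canonical» IN THE KERNEL** (R26.13 (a)ʼs register row): at bed 178ʼs last centre, COORDINATE canonicity holds and IDEAL-THEORETIC canonicity fails — so the one-step
negative ✓ `not_mc8cOneStep_coordCanonical` refutes the cc proxy door only, not `MC8cOneStep TopLocusIs`. [OURS · kernel] -/
theorem coordCanonical_and_not_topLocusIs [CharP K 11] : CoordCanonical (S K) Nor ∧ ¬ TopLocusIs (S K) Nor :=
  ⟨coordCanonical K, not_topLocusIs K⟩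

/-! ## §2 The drop-point budget at `S′` (`DropBudget` of `Lines/T_canon_door.lean` v6.2, res-L1-w45a-plan-1 R26.21 (β)) and the v6.2 form of the one-step negative -/

/-- `Nor.erase L = {e₁, y₃}`. [plumbing] -/
theorem nor_erase_L : (Nor).erase L = ({1, 2} : Finset Letter) := by decide

/-- The monomial `y₁³y₃⁶` of `Disc_x(S)` (coefficient `4`) survives in `Disc_x(S′)`: `coeff_e Disc_x(S′) = coeff_{τe} σ_L(Disc_x S) = coeff_e Disc_x(S)` since `τe = e + 6ε_{y₁}` (`ndeg_{Nor∖L} e = 6`)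
and `σ_L(Disc_x S) = y₁⁶·Disc_x(S′)` (✓ `disc_chart`, ✓ `coeff_tau_chartMap`). [OURS · certificate on ✓p729098] -/
theorem mem_support_D' [CharP K 11] : (Finsupp.equivFunOnFinite.symm (![3, 0, 6, 0] : Fin 4 → ℕ) : Expo) ∈ (S' K).D.support := by
  have hN : (Finsupp.equivFunOnFinite.symm (![3, 0, 6, 0] : Fin 4 → ℕ) : Expo) ∈ (N K).support :=
    mem_support_evalL_of_not_dvd 11 NL _ (by decide)
  have hD : coeff (Finsupp.equivFunOnFinite.symm (![3, 0, 6, 0] : Fin 4 → ℕ) : Expo) (S K).D ≠ 0 := by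
    rw [(isResidual K).1, show (α : Expo) = 0 from rfl, ← zero_add (Finsupp.equivFunOnFinite.symm (![3, 0, 6, 0] : Fin 4 → ℕ) : Expo),
      coeff_monomial_mul, one_mul]
    exact MvPolynomial.mem_support_iff.mp hN
  have h1 := LastCentreAxisOrder.coeff_tau_chartMap Nor L (S K).D (Finsupp.equivFunOnFinite.symm (![3, 0, 6, 0] : Fin 4 → ℕ) : Expo)
  have htau : tau Nor L (Finsupp.equivFunOnFinite.symm (![3, 0, 6, 0] : Fin 4 → ℕ) : Expo) =
      Finsupp.single L 6 + Finsupp.equivFunOnFinite.symm (![3, 0, 6, 0] : Fin 4 → ℕ) := by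
    rw [LastCentreAxisOrder.tau_apply, add_comm, nor_erase_L]
    congr 2
  rw [LastCentreAxisOrder.disc_chart (isChart K), htau, X_pow_eq_monomial, coeff_monomial_mul, one_mul] at h1
  rw [MvPolynomial.mem_support_iff, h1]
  exact hD

/-- ★ `DropBudget S′` (v6.2, stated unfolded): `ω′ ≤ 9 ≤ 8 + 2·(d′_{y₁} + d′_{e₁} + d′_{e₂}) = 16` — witness `y₁³y₃⁶ ∈ supp Disc_x(S′)`. [OURS · certificate] -/
theorem dropBudget [CharP K 11] : ∃ e ∈ (S' K).D.support, (tdeg e : ℤ) ≤ 8 + 2 * ∑ n ∈ (S' K).Exc, (S' K).d n := by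
  refine ⟨_, mem_support_D' K, ?_⟩
  rw [LastCentreBedC.tdeg_eq]
  simp [S', Finset.sum_insert]

/-- ★★★ **THE v6.2 ONE-STEP DOOR `MC8cOneStep CoordCanonical` — WITH THE DROP-POINT BUDGET `DropBudget S′` AS AN EXTRA HYPOTHESIS (R26.21 (β)) — IS STILL FALSE**: restated VERBATIM from
`Lines/T_canon_door.lean` v6.2 §3 (`DropBudget` unfolded), refuted by the same bed-178 instance over `ZMod 11`. [OURS · kernel negative; res-L1-w45a-plan-1 booking of v6.2, l.39575] -/
theorem not_mc8cOneStep_dropBudget_coordCanonical :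
    ¬ (∀ (k : Type) [Field k] (S S' : Stage k) (Nor : Finset Letter) (L : Letter) (α α' : Expo) (N N' : YPoly k),
        Nor.Nonempty → L ∈ Nor → Permissible S Nor → CoordCanonical S Nor → Budgeted S →
          IsChart S Nor L S' → IsDropPoint S' → (∃ e ∈ S'.D.support, (tdeg e : ℤ) ≤ 8 + 2 * ∑ n ∈ S'.Exc, S'.d n) → Budgeted S' →
            IsResidual S.Exc S.D α N → IsResidual S'.Exc S'.D α' N' → OrdLE N' 8) := by
  intro h
  haveI : Fact (Nat.Prime 11) := ⟨by norm_num⟩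
  obtain ⟨α', N', hN'⟩ := exists_isResidual' (ZMod 11)
  exact not_rho'_le_eight (ZMod 11) hN' (h (ZMod 11) (S _) (S' _) Nor L α α' (N _) N' nor_facts.1 nor_facts.2.2 (permissible _)
    (coordCanonical _) (budgeted_S _) (isChart _) (isDropPoint _) (dropBudget _) (budgeted_S' _) (isResidual _) hN')

end Summit.ResolutionOfSingularities.ResolutionOfSingularities.Theorems.FInjectiveMacaulayfication.LastCentreBed178

end
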